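import Literature.Combinatorics.SimpleGraph.MooreBound
import Literature.Combinatorics.SimpleGraph.MooreBoundGrowth
import Literature.Combinatorics.SimpleGraph.MooreBoundPaths
import Mathlib.Combinatorics.SimpleGraph.DegreeSum
import Mathlib.Combinatorics.SimpleGraph.DeleteEdges
import Mathlib.Analysis.SpecialFunctions.Pow.Real
import HarnessLib

/-!
# Proof of the Alon–Hoory–Linial Moore bound for irregular graphs

This file discharges the named fact
`Literature.Combinatorics.SimpleGraph.alonHooryLinial_mooreBound` (`MooreBound.lean`):
**Theorem 1 of [AlonHooryLinial2002]** — a graph of girth `g` and average degree `≥ d ≥ 2` has at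
least `n₀(d, g)` vertices — as `alonHooryLinial_mooreBound_holds`.

Proof architecture (following [AlonHooryLinial2002, pp. 54–56], with the analytic step replaced by
the log-sum induction of `MooreBoundGrowth.lean` and the non-backtracking walks replaced by short
paths, `MooreBoundPaths.lean`); auxiliary declarations live in the sub-namespace
`IrregularMoore`:

1. `IrregularMoore.core` — the theorem for a graph all of whose non-isolated ("live", `∈ S`)
   vertices have degree `≥ 2`: the growth lemma gives
   `∑_{darts} pathCount j ≥ 2|E| · Λ^j` with `Λ ≥ 2|E|/#S - 1 ≥ d - 1`
   (`IrregularMoore.dartSum_ge_pow`), and the girth makes the short paths from a vertex (odd `g`)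
   or from an edge (even `g`) end at distinct live vertices (`odd_count`, `even_count`).
2. `IrregularMoore.reduction` — vertices of degree `≤ 1` are deleted one at a time
   (`SimpleGraph.deleteIncidenceSet`); this keeps the girth `≥ g` and the average degree `≥ d`
   because `d ≥ 2` ([AlonHooryLinial2002, p. 54, first paragraph of the proof]).
3. `alonHooryLinial_mooreBound_holds` — specialisation to `Fin n`, `G.egirth = g`,
   `G.edgeSet.ncard`.

## References

* N. Alon, S. Hoory, N. Linial, The Moore bound for irregular graphs, *Graphs Combin.* 18
  (2002) 53–57, Theorem 1 [AlonHooryLinial2002].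
-/

namespace Literature.Combinatorics.SimpleGraph

namespace IrregularMoore

open Finset _root_.SimpleGraph

variable {V : Type*} [Fintype V] [DecidableEq V]

section Core

variable (H : _root_.SimpleGraph V) [DecidableRel H.Adj] (S : Finset V)

omit [DecidableEq V] in
/-- If `S` contains every vertex that has a neighbour, vertices outside `S` are isolated.
[folklore] -/
theorem neighborFinset_eq_empty_of_notMem (hS : ∀ ⦃a b⦄, H.Adj a b → b ∈ S) {v : V}
    (hv : v ∉ S) : H.neighborFinset v = ∅ := by
  rw [Finset.eq_empty_iff_forall_notMem]
  intro w hw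
  rw [mem_neighborFinset] at hw
  exact hv (hS hw.symm)

omit [DecidableEq V] in
/-- Degree sum over the live set: `∑_{v ∈ S} deg v = 2|E|`. [folklore] -/
theorem sum_degree_eq (hS : ∀ ⦃a b⦄, H.Adj a b → b ∈ S) :
    ∑ v ∈ S, (H.degree v : ℝ) = 2 * #H.edgeFinset := by
  have h1 : ∑ v ∈ S, (H.degree v : ℝ) = ∑ v, (H.degree v : ℝ) := by
    refine Finset.sum_subset (Finset.subset_univ S) fun v _ hv => ?_
    rw [← card_neighborFinset_eq_degree, neighborFinset_eq_empty_of_notMem H S hS hv]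
    simp
  rw [h1]
  exact_mod_cast H.sum_degrees_eq_twice_card_edges

/-- The growth lemma applied to path counts: for `j ≤ J`, `J + 2 ≤ g ≤ girth`,
`m · exp (j Λ'/m) ≤ ∑_v ∑_{u ∼ v} pathCount j u v` with `m = ∑ deg`,
`Λ' = ∑ deg · log (deg - 1)`. [cite: AlonHooryLinial2002, p. 55] -/
theorem dartSum_ge (hS : ∀ ⦃a b⦄, H.Adj a b → b ∈ S) (hdeg : ∀ v ∈ S, 2 ≤ H.degree v)
    {g : ℕ} (hg : (g : ℕ∞) ≤ H.egirth) {J : ℕ} (hJ : J + 2 ≤ g) {j : ℕ} (hj : j ≤ J) :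
    (∑ v, (H.degree v : ℝ)) *
        Real.exp ((j : ℝ) * (∑ v, (H.degree v : ℝ) * Real.log (H.degree v - 1))
          / ∑ v, (H.degree v : ℝ))
      ≤ ∑ v, ∑ u ∈ H.neighborFinset v, (pathCount H j u v : ℝ) := by
  have hsymm : ∀ u v, u ∈ H.neighborFinset v → v ∈ H.neighborFinset u := by
    intro u v h
    rw [mem_neighborFinset] at h ⊢
    exact h.symm
  have htwo : ∀ v, (H.neighborFinset v).Nonempty → 2 ≤ #(H.neighborFinset v) := by
    rintro v ⟨w, hw⟩
    rw [mem_neighborFinset] at hw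
    rw [card_neighborFinset_eq_degree]
    exact hdeg v (hS hw.symm)
  have h0 : ∀ v, ∀ u ∈ H.neighborFinset v, (1 : ℝ) ≤ (pathCount H 0 u v : ℝ) := by
    intro v u hu
    rw [mem_neighborFinset] at hu
    rw [pathCount_zero H hu.ne']
    simp
  have hrec : ∀ i < J, ∀ v, ∀ u ∈ H.neighborFinset v,
      ∑ w ∈ (H.neighborFinset v).erase u, (pathCount H i v w : ℝ)
        ≤ (pathCount H (i + 1) u v : ℝ) := by
    intro i hi v u hu
    rw [mem_neighborFinset] at hu
    rw [pathCount_succ H hg hu.symm i (by omega)]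
    push_cast
    exact le_rfl
  exact growth hsymm htwo h0 hrec hj

/-- `∑_{darts} pathCount j ≥ 2|E| (d - 1)^j` for `j ≤ J`, `J + 2 ≤ g`: the growth lemma combined
with the degree convexity `Λ ≥ d̄ - 1 ≥ d - 1`. [cite: AlonHooryLinial2002, p. 55] -/
theorem dartSum_ge_pow (hS : ∀ ⦃a b⦄, H.Adj a b → b ∈ S) (hdeg : ∀ v ∈ S, 2 ≤ H.degree v)
    (hSne : S.Nonempty) {g : ℕ} (hg : (g : ℕ∞) ≤ H.egirth) {J : ℕ} (hJ : J + 2 ≤ g) {d : ℝ}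
    (hd : 2 ≤ d) (havg : d * #S ≤ 2 * #H.edgeFinset) {j : ℕ} (hj : j ≤ J) :
    2 * #H.edgeFinset * (d - 1) ^ j ≤ ∑ v, ∑ u ∈ H.neighborFinset v, (pathCount H j u v : ℝ) := by
  have hgrowth := dartSum_ge H S hS hdeg hg hJ hj
  have hm : ∑ v, (H.degree v : ℝ) = 2 * #H.edgeFinset := by
    exact_mod_cast H.sum_degrees_eq_twice_card_edges
  have hmS : ∑ v ∈ S, (H.degree v : ℝ) = 2 * #H.edgeFinset := sum_degree_eq H S hS
  have hΛ : ∑ v, (H.degree v : ℝ) * Real.log (H.degree v - 1)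
      = ∑ v ∈ S, (H.degree v : ℝ) * Real.log (H.degree v - 1) := by
    symm
    refine Finset.sum_subset (Finset.subset_univ S) fun v _ hv => ?_
    rw [← card_neighborFinset_eq_degree, neighborFinset_eq_empty_of_notMem H S hS hv]
    simp
  have hSpos : (0 : ℝ) < #S := by exact_mod_cast hSne.card_pos
  have hmpos : (0 : ℝ) < 2 * #H.edgeFinset := lt_of_lt_of_le (by positivity) havg
  -- degree convexity: `m log (m/#S - 1) ≤ Λ'`
  have hB := sum_mul_log_sub_one_ge S hSne (fun v => (H.degree v : ℝ))
    (fun v hv => by exact_mod_cast hdeg v hv)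
  rw [hmS, ← hΛ] at hB
  rw [hm] at hgrowth
  -- compare the exponents
  have hd1 : d - 1 ≤ 2 * #H.edgeFinset / #S - 1 := by
    rw [le_sub_iff_add_le, sub_add_cancel, le_div_iff₀ hSpos]
    exact havg
  have hexp : (d - 1) ^ j ≤ Real.exp ((j : ℝ) *
      (∑ v, (H.degree v : ℝ) * Real.log (H.degree v - 1)) / (2 * #H.edgeFinset)) := by
    have hy : (0 : ℝ) < 2 * (#H.edgeFinset : ℝ) / #S - 1 := by linarith
    calc (d - 1) ^ j ≤ (2 * #H.edgeFinset / #S - 1) ^ j :=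
          pow_le_pow_left₀ (by linarith) hd1 j
      _ = Real.exp ((j : ℝ) * Real.log (2 * #H.edgeFinset / #S - 1)) := by
          rw [Real.exp_nat_mul, Real.exp_log hy]
      _ ≤ _ := by
          apply Real.exp_le_exp.mpr
          rw [le_div_iff₀ hmpos, mul_assoc]
          exact mul_le_mul_of_nonneg_left (by simpa [mul_comm] using hB) (Nat.cast_nonneg j)
  calc 2 * #H.edgeFinset * (d - 1) ^ j
      ≤ 2 * #H.edgeFinset * Real.exp ((j : ℝ) *
          (∑ v, (H.degree v : ℝ) * Real.log (H.degree v - 1)) / (2 * #H.edgeFinset)) :=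
        mul_le_mul_of_nonneg_left hexp (le_of_lt hmpos)
    _ ≤ _ := hgrowth

omit [DecidableEq V] in
/-- Sums over darts restricted to the live set. [folklore] -/
theorem sum_live_eq (hS : ∀ ⦃a b⦄, H.Adj a b → b ∈ S) (F : V → V → ℝ) :
    ∑ v ∈ S, ∑ u ∈ H.neighborFinset v, F u v = ∑ v, ∑ u ∈ H.neighborFinset v, F u v := by
  refine Finset.sum_subset (Finset.subset_univ S) fun v _ hv => ?_
  rw [neighborFinset_eq_empty_of_notMem H S hS hv, Finset.sum_empty]

/-- Reversing all darts does not change a dart sum. [folklore] -/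
theorem dartSum_swap (F : V → V → ℝ) :
    ∑ v, ∑ u ∈ H.neighborFinset v, F v u = ∑ v, ∑ u ∈ H.neighborFinset v, F u v :=
  sum_nbr_comm (fun v => H.neighborFinset v)
    (fun u v h => by rw [mem_neighborFinset] at h ⊢; exact h.symm) (fun u v => F v u)

omit [DecidableEq V] in
/-- Pulling a finite sum out of a dart sum. [folklore] -/
theorem dartSum_sum (r : ℕ) (F : ℕ → V → V → ℝ) :
    ∑ v, ∑ u ∈ H.neighborFinset v, ∑ i ∈ Finset.range r, F i u v
      = ∑ i ∈ Finset.range r, ∑ v, ∑ u ∈ H.neighborFinset v, F i u v := by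
  calc ∑ v, ∑ u ∈ H.neighborFinset v, ∑ i ∈ Finset.range r, F i u v
      = ∑ v, ∑ i ∈ Finset.range r, ∑ u ∈ H.neighborFinset v, F i u v :=
        Finset.sum_congr rfl fun v _ => Finset.sum_comm
    _ = ∑ i ∈ Finset.range r, ∑ v, ∑ u ∈ H.neighborFinset v, F i u v := Finset.sum_comm

/-- **Core case, odd girth** `g = 2r+1`: `1 + d ∑_{i<r} (d-1)^i ≤ #S`.
[cite: AlonHooryLinial2002, p. 56] -/
theorem core_odd (hS : ∀ ⦃a b⦄, H.Adj a b → b ∈ S) (hdeg : ∀ v ∈ S, 2 ≤ H.degree v)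
    (hSne : S.Nonempty) {r : ℕ} (hr : 1 ≤ r) (hg : ((2 * r + 1 : ℕ) : ℕ∞) ≤ H.egirth) {d : ℝ}
    (hd : 2 ≤ d) (havg : d * #S ≤ 2 * #H.edgeFinset) :
    1 + d * ∑ i ∈ Finset.range r, (d - 1) ^ i ≤ #S := by
  have hSpos : (0 : ℝ) < #S := by exact_mod_cast hSne.card_pos
  -- girth counting, summed over `v ∈ S`
  have hcount : ∀ v ∈ S, (1 : ℝ) + ∑ i ∈ Finset.range r, ∑ w ∈ H.neighborFinset v,
      (pathCount H i v w : ℝ) ≤ #S := by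
    intro v hv
    exact_mod_cast odd_count H S hS hg r le_rfl hv
  have hsum := Finset.sum_le_sum hcount
  rw [Finset.sum_add_distrib, Finset.sum_const, nsmul_eq_mul, mul_one, Finset.sum_comm,
    Finset.sum_const, nsmul_eq_mul] at hsum
  -- `hsum : #S + ∑ i<r, ∑ v∈S, ∑ w∼v, pathCount i v w ≤ #S * #S`
  have hD : ∀ i ∈ Finset.range r, d * #S * (d - 1) ^ i
      ≤ ∑ v ∈ S, ∑ w ∈ H.neighborFinset v, (pathCount H i v w : ℝ) := by
    intro i hi
    rw [Finset.mem_range] at hi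
    have h1 := dartSum_ge_pow H S hS hdeg hSne hg (J := r - 1) (by omega) hd havg (j := i)
      (by omega)
    rw [sum_live_eq H S hS (fun w v => (pathCount H i v w : ℝ)),
      dartSum_swap H (fun u v => (pathCount H i u v : ℝ))]
    calc d * #S * (d - 1) ^ i ≤ 2 * #H.edgeFinset * (d - 1) ^ i := by
          apply mul_le_mul_of_nonneg_right havg
          exact pow_nonneg (by linarith) i
      _ ≤ _ := h1
  have hD' := Finset.sum_le_sum hD
  rw [← Finset.mul_sum] at hD'
  have key : (#S : ℝ) * (1 + d * ∑ i ∈ Finset.range r, (d - 1) ^ i) ≤ #S * #S := by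
    nlinarith [hD', hsum]
  exact le_of_mul_le_mul_left (by linarith [key]) hSpos

/-- **Core case, even girth** `g = 2r`: `2 ∑_{i<r} (d-1)^i ≤ #S`.
[cite: AlonHooryLinial2002, p. 56] -/
theorem core_even (hS : ∀ ⦃a b⦄, H.Adj a b → b ∈ S) (hdeg : ∀ v ∈ S, 2 ≤ H.degree v)
    (hSne : S.Nonempty) {r : ℕ} (hr : 2 ≤ r) (hg : ((2 * r : ℕ) : ℕ∞) ≤ H.egirth) {d : ℝ}
    (hd : 2 ≤ d) (havg : d * #S ≤ 2 * #H.edgeFinset) :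
    2 * ∑ i ∈ Finset.range r, (d - 1) ^ i ≤ #S := by
  have hSpos : (0 : ℝ) < #S := by exact_mod_cast hSne.card_pos
  have hmpos : (0 : ℝ) < 2 * #H.edgeFinset := lt_of_lt_of_le (by positivity) havg
  have hm : ∑ v, (H.degree v : ℝ) = 2 * #H.edgeFinset := by
    exact_mod_cast H.sum_degrees_eq_twice_card_edges
  -- girth counting, summed over all darts `(u, v)`, `u ∼ v`
  have hcount : ∀ v, ∀ u ∈ H.neighborFinset v,
      ∑ i ∈ Finset.range r, (pathCount H i u v : ℝ)
        + ∑ i ∈ Finset.range r, (pathCount H i v u : ℝ) ≤ #S := by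
    intro v u hu
    rw [mem_neighborFinset] at hu
    exact_mod_cast even_count H S hS hg r le_rfl hu.symm (hS hu) (hS hu.symm)
  have hsum : ∑ v, ∑ u ∈ H.neighborFinset v, (∑ i ∈ Finset.range r, (pathCount H i u v : ℝ)
      + ∑ i ∈ Finset.range r, (pathCount H i v u : ℝ))
        ≤ ∑ v, ∑ u ∈ H.neighborFinset v, (#S : ℝ) :=
    Finset.sum_le_sum fun v _ => Finset.sum_le_sum fun u hu => hcount v u hu
  have hrhs : ∑ v, ∑ u ∈ H.neighborFinset v, (#S : ℝ) = 2 * #H.edgeFinset * #S := by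
    simp only [Finset.sum_const, nsmul_eq_mul, card_neighborFinset_eq_degree]
    rw [← Finset.sum_mul, hm]
  have hlhs : ∑ v, ∑ u ∈ H.neighborFinset v, (∑ i ∈ Finset.range r, (pathCount H i u v : ℝ)
      + ∑ i ∈ Finset.range r, (pathCount H i v u : ℝ))
      = 2 * ∑ i ∈ Finset.range r, ∑ v, ∑ u ∈ H.neighborFinset v, (pathCount H i u v : ℝ) := by
    rw [two_mul]
    have hsplit : ∑ v, ∑ u ∈ H.neighborFinset v, (∑ i ∈ Finset.range r, (pathCount H i u v : ℝ)
        + ∑ i ∈ Finset.range r, (pathCount H i v u : ℝ))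
        = ∑ v, ∑ u ∈ H.neighborFinset v, ∑ i ∈ Finset.range r, (pathCount H i u v : ℝ)
          + ∑ v, ∑ u ∈ H.neighborFinset v, ∑ i ∈ Finset.range r, (pathCount H i v u : ℝ) := by
      rw [← Finset.sum_add_distrib]
      exact Finset.sum_congr rfl fun v _ => Finset.sum_add_distrib
    rw [hsplit, dartSum_sum H r (fun i u v => (pathCount H i u v : ℝ)),
      dartSum_sum H r (fun i u v => (pathCount H i v u : ℝ))]
    congr 1
    exact Finset.sum_congr rfl fun i _ => dartSum_swap H (fun u v => (pathCount H i u v : ℝ))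
  rw [hlhs, hrhs] at hsum
  have hD : ∀ i ∈ Finset.range r, 2 * #H.edgeFinset * (d - 1) ^ i
      ≤ ∑ v, ∑ u ∈ H.neighborFinset v, (pathCount H i u v : ℝ) := by
    intro i hi
    rw [Finset.mem_range] at hi
    exact dartSum_ge_pow H S hS hdeg hSne hg (J := r - 1) (by omega) hd havg (j := i) (by omega)
  have hD' := Finset.sum_le_sum hD
  rw [← Finset.mul_sum] at hD'
  have key : 2 * (#H.edgeFinset : ℝ) * (2 * ∑ i ∈ Finset.range r, (d - 1) ^ i)
      ≤ 2 * #H.edgeFinset * #S := by nlinarith [hD', hsum]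
  exact le_of_mul_le_mul_left key hmpos

/-- **Core theorem**: the Moore bound for a graph all of whose live vertices have degree `≥ 2`
(girth `≥ g ≥ 3`, average degree over the live set `≥ d ≥ 2`).
[cite: AlonHooryLinial2002, Thm 1, min-degree-2 case] -/
theorem core (hS : ∀ ⦃a b⦄, H.Adj a b → b ∈ S) (hdeg : ∀ v ∈ S, 2 ≤ H.degree v)
    (hSne : S.Nonempty) {g : ℕ} (hg3 : 3 ≤ g) (hg : (g : ℕ∞) ≤ H.egirth) {d : ℝ} (hd : 2 ≤ d)
    (havg : d * #S ≤ 2 * #H.edgeFinset) : mooreBound d g ≤ #S := by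
  obtain ⟨r, hr | hr⟩ := Nat.even_or_odd' g
  · subst hr
    have hr2 : 2 ≤ r := by omega
    rw [mooreBound, if_pos (even_two_mul r), Nat.mul_div_cancel_left r two_pos]
    exact core_even H S hS hdeg hSne hr2 hg hd havg
  · subst hr
    have hr1 : 1 ≤ r := by omega
    have hdiv : (2 * r + 1) / 2 = r := by omega
    rw [mooreBound, if_neg (Nat.not_even_iff_odd.mpr (odd_two_mul_add_one r)), hdiv]
    exact core_odd H S hS hdeg hSne hr1 hg hd havg

end Core

section Reduction

/-- **Reduction to minimum degree two**: deleting a live vertex of degree `≤ 1` keeps the girth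
`≥ g` and keeps the average degree over the live set `≥ d` (because `d ≥ 2`); induction on the
size of the live set. [cite: AlonHooryLinial2002, p. 54] -/
theorem reduction {g : ℕ} (hg3 : 3 ≤ g) {d : ℝ} (hd : 2 ≤ d) :
    ∀ (k : ℕ) (H : _root_.SimpleGraph V) [DecidableRel H.Adj] (S : Finset V), #S = k →
      (∀ ⦃a b⦄, H.Adj a b → b ∈ S) → S.Nonempty → (g : ℕ∞) ≤ H.egirth →
      d * k ≤ 2 * #H.edgeFinset → mooreBound d g ≤ k := by
  intro k
  induction k with
  | zero =>
    intro H _ S h0 _ hne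
    exact absurd h0 hne.card_pos.ne'
  | succ k ih =>
    intro H _ S hSk hS hne hgH havg
    by_cases hmin : ∀ v ∈ S, 2 ≤ H.degree v
    · have hc := core H S hS hmin hne hg3 hgH hd (by rw [hSk]; exact_mod_cast havg)
      rw [hSk] at hc
      exact_mod_cast hc
    push Not at hmin
    obtain ⟨v, hvS, hdv⟩ := hmin
    have hEv : #(H.deleteIncidenceSet v).edgeFinset + H.degree v = #H.edgeFinset := by
      rw [H.card_edgeFinset_deleteIncidenceSet v, Nat.sub_add_cancel]
      rw [← card_incidenceFinset_eq_degree]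
      exact Finset.card_le_card (H.incidenceFinset_subset v)
    have hS' : ∀ ⦃a b⦄, (H.deleteIncidenceSet v).Adj a b → b ∈ S.erase v := by
      intro a b hab
      rw [deleteIncidenceSet_adj] at hab
      exact Finset.mem_erase.mpr ⟨hab.2.2, hS hab.1⟩
    have hcard' : #(S.erase v) = k := by
      rw [Finset.card_erase_of_mem hvS, hSk]
      rfl
    rcases Nat.eq_zero_or_pos k with hk | hk
    · -- `S = {v}`: then `H` has no edge at all, contradicting `d ≤ 2|E|`
      exfalso
      subst hk
      have hSv : S = {v} := by
        obtain ⟨a, ha⟩ := Finset.card_eq_one.mp hSk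
        rw [ha] at hvS ⊢
        rw [Finset.mem_singleton.mp hvS]
      have hdeg0 : (H.degree v : ℝ) = 0 := by
        rw [← card_neighborFinset_eq_degree]
        have : H.neighborFinset v = ∅ := by
          rw [Finset.eq_empty_iff_forall_notMem]
          intro w hw
          rw [mem_neighborFinset] at hw
          have hwS := hS hw
          rw [hSv, Finset.mem_singleton] at hwS
          exact hw.ne hwS.symm
        rw [this]
        simp
      have hE := sum_degree_eq H S hS
      rw [hSv, Finset.sum_singleton, hdeg0] at hE
      push_cast at havg
      linarith
    · have hne' : (S.erase v).Nonempty := by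
        rw [← Finset.card_pos, hcard']
        exact hk
      have hg' : (g : ℕ∞) ≤ (H.deleteIncidenceSet v).egirth :=
        le_trans hgH (egirth_anti (H.deleteIncidenceSet_le v))
      have havg' : d * k ≤ 2 * #(H.deleteIncidenceSet v).edgeFinset := by
        have h1 : (#(H.deleteIncidenceSet v).edgeFinset : ℝ) + H.degree v = #H.edgeFinset := by
          exact_mod_cast hEv
        have h2 : (H.degree v : ℝ) ≤ 1 := by
          have : H.degree v ≤ 1 := by omega
          exact_mod_cast this
        push_cast at havg
        nlinarith
      have := ih (H.deleteIncidenceSet v) (S.erase v) hcard' hS' hne' hg' havg'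
      push_cast
      linarith

end Reduction

end IrregularMoore

open Finset _root_.SimpleGraph IrregularMoore in
/-- **Alon–Hoory–Linial, the Moore bound for irregular graphs** [cite: AlonHooryLinial2002, Thm 1]:
discharge of the named fact `alonHooryLinial_mooreBound` — a simple graph on `Fin n` of girth
exactly `g` (`G.egirth = g`) and average degree `2|E|/n ≥ d ≥ 2` has `n ≥ n₀(d, g)` vertices.
Proof: `IrregularMoore.reduction` + `IrregularMoore.core` (see the module docstring). -/
theorem alonHooryLinial_mooreBound_holds : alonHooryLinial_mooreBound := by
  intro n g d G hgirth hd havg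
  classical
  have hg3 : 3 ≤ g := by
    have h := three_le_egirth (G := G)
    rw [hgirth] at h
    exact_mod_cast h
  have hn : 0 < n := by
    rcases Nat.eq_zero_or_pos n with rfl | h
    · exfalso
      have hac : G.IsAcyclic := IsAcyclic.of_subsingleton
      have := egirth_eq_top.mpr hac
      rw [hgirth] at this
      exact ENat.coe_ne_top _ this
    · exact h
  haveI : Nonempty (Fin n) := ⟨⟨0, hn⟩⟩
  have hE : (G.edgeSet.ncard : ℝ) = #G.edgeFinset := by
    rw [Set.ncard_eq_toFinset_card' G.edgeSet]
    rfl
  have key := reduction (V := Fin n) hg3 hd n G Finset.univ (by simp)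
    (fun a b _ => Finset.mem_univ b) Finset.univ_nonempty (le_of_eq hgirth.symm)
    (by rw [← hE]; exact havg)
  exact key

end Literature.Combinatorics.SimpleGraph
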